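import Summits.ABC.IUTFork.Joshi.TestIsmScaling
import HarnessLib

/-!
# Block E, test X-07′ — the «Joshi-style (Ind2)» instantiation at the pinned carriers, II: the TEST THEOREMS

Proof-only file (D-0012; no `Prop` fact) of the abc-iut cell, block E (rung LADDER-ABC:A2.E; seat abc-iut-E-t41, slot T-41 = test row
**X-07′**; rulings abc-iut-E-plan 2026-08-26T06:50:08Z / 06:55:58Z, sign-off criterion abc-iut-E-cx 06:50:46Z (i)–(v)). TAKES NO SIDE on
[IUTchIII] Cor. 3.12, on Joshi's claims or on Mochizuki's report on them. Part II of the X-07′ files (`TestIsmScalingShells` ⟵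
`TestIsmScaling` ⟵ this); the model, its rationale and the zero-label convention are described in `TestIsmScaling`. One new definition:
the region operator `scalRegion` (the pinned `orbitRegion` with the forced zero-label convention `univ`).

THE MODEL IN ONE LINE: abc-iut-w4-d101's pinned naive `p`-adic model of record with the ONE field `LogShells.ism` enlarged from the signs
`{±1}` to ALL ℚ-linear automorphisms of the line (K. Joshi, arXiv:2401.13508v4, §8.11.1 p. 91 l. 44–46 «ℚ_p-linear isomorphisms σ» = E-lit
EL-040; versus [IUTchII] Ex. 1.8 (iv) / [IUTchIII] Prop. 1.2 (vi) «Ism», EL-079).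

RESULTS (all closed, axioms standard; `S` = `scalFull p`, `P` = `scalSetting p`, `ρ` = `scalRegion p`, `qK` = abc-iut-w4-d101's `qDatum p`):
* (d) PINS REPORT — ALL FOUR HOLD, each by theorem: (hρ) `scalRegion_equivariant` (for EVERY packet-automorphism family, a fortiori for
  the LARGER group: every such family is a scalar on each line, `exists_scalar`), (pΘ) `scalSetting_thetaPinned`, (pq′) `scalSetting_qPinned`,
  (pL) `scalSetting_pilotLink`; `scalSetting_pinnedRegions3`.
* (a) **S IS REACHED**: `scalSetting_pilotKummerIndRelated : PilotKummerIndRelated S P ρ qK`, from the ONE explicit (Ind2)-family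
  `untiltFamily` (`p^{1−j²}` on the factor `0` at label `j`) through abc-iut-E-cx's template `Joshi.pilotKummerIndRelated_of_untiltChange`:
  `UntiltChangeIsInd ∧ UntiltChangeCarriesQ` HOLD (`scalSetting_untiltChange`) — the conjunction X-06 (`Joshi.not_untiltChange_of_logvolInvariant`)
  refutes wherever (Ind1)/(Ind2) preserve log-volume; also abc-iut-w5-d068's datum-level printed clause `PilotKummerCompat`
  (`scalSetting_pilotKummerCompat`: `qK = untiltFamily · Ψ_v` on the nose), `IndCoversQ`, Reading R3 (`scalSetting_reading3`), the (xi-f) `Licence`.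
* (c) **`¬ MRData.LogvolInvariant`** (`scalSetting_not_logvolInvariant`: `dilateFamily` carries `B_0` onto `B_{−1}`, of log-volume `log p ≠ 0`).
* (b′) **THE TYPED STATEMENT FAILS**: at every `(j ∈ 𝔽_l^⋆, v_ℚ)` every hull-set `B_K` misses the possible image `B_{K−1}` (`scalSetting_escapes`;
  `possibleImages = {B_e}_{e ∈ ℤ}`, part I), hence — abc-iut-E-cx's `Joshi.not_hullDefined_of_escapes` / `not_statement_of_escapes`
  (DictionaryHarnessBridge p429682) BY NAME — `¬ HullDefined`, `thetaLocal = ⊤`, `¬ ThetaFinite`, `negLogTheta = ⊤` («−|log(Θ)| = +∞»: the Θ-hull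
  is the whole line), **`¬ P.Statement` and `¬ BridgeHyps P`**.
* BRIDGE-HYPOTHESES CENSUS: `BridgeHyps` fails AT EXACTLY ONE CLAUSE, `finite` (= c312-7's `ThetaFinite`): `LogvolMono`, `image_adm`,
  `image_fin`, `hul_nonempty`, `theta_nonempty` are PROVED (`scalSetting_bridge_census`); `AbsLogQPos` holds (`−|log(q)| = −log p`).
* `scal_test_X07'` — the packaged TEST line; `exists_S_and_not_statement` — its ∃-form.

READING (located, not adjudicated; E-plan 06:50:08Z «trichotomy»): in the cell's typed framework — Θ-hull := hull of the FULL
`⟨(Ind1) ∪ (Ind2)⟩`-orbit — an (Ind2) by isometries cannot reach S (X-06), while an (Ind2) admitting Joshi's valuation-rescaling σ REACHES S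
(and the pins, R3, the Licence, the printed Kummer-compatibility clause) but makes the typed `−|log(Θ)|` infinite, so the typed Statement fails
by its first conjunct and every bridge theorem of the cell is inapplicable for want of `BridgeHyps.finite`; Joshi's own computation never
forms a hull over an indeterminacy orbit ([J-III] p. 127 l. 41–55). Which (Ind2) [IUTchIII] intends is the E6 attach point, recorded, not
adjudicated. Interface-level witness over `toyIndex`; NOT a model of initial Θ-data; typed ≠ proved ≠ endorsed.
[claim: Mochizuki2012, status: disputed] [claim: Joshi2024ATS3, status: disputed] [cite: ScholzeStix2018, §2.2 pp. 9–10]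
-/

noncomputable section

open Set

namespace Summit.ABC.IUTFork.Joshi.IsmScaling

open Thm311 Cor312 Cor312.Checks Cor312.IdentifiedNonVacuity Cor312Vol Cor312Vol.NaiveWitness Cor312Vol.PinnedWitness
  Literature.IUT.LogThetaLattice

variable (p : ℕ)

/-! ## 1. The region operator and the pins -/

/-- **The monoid-to-region operator `Ψ ↦ Ψ_j·𝒪`** of the model of record (`PinnedWitness.orbitRegion`: at `j ∈ 𝔽_l^⋆` the orbit of
`𝒪 = B_0` under the `j`-components of the elements of `Ψ`) with the FORCED zero-label convention `univ` at the component-free label `j = 0`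
(no ball is invariant under a valuation-rescaling, while (hρ) demands invariance there; module docstring of `TestIsmScaling`).
[claim: Mochizuki2012, status: disputed] -/
def scalRegion (Ψ : ∀ v : toyIndex.V, v ∈ toyIndex.Vbad → Set (signShells.StarPacket v)) (j : toyIndex.Label) (vQ : toyIndex.VQ) :
    Set (signShells.Packet j vQ) :=
  if h : j = 0 then Set.univ else
    {x | ∃ ψ ∈ Ψ vQ (Set.mem_univ _), ∃ u ∈ pBall p j vQ 0, line j vQ x = line j vQ (ψ ⟨j, h⟩) * line j vQ u}

/-- At the zero label the operator returns the convention `univ`. [folklore] -/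
theorem scalRegion_zero (Ψ : ∀ v : toyIndex.V, v ∈ toyIndex.Vbad → Set (signShells.StarPacket v)) (vQ : toyIndex.VQ) :
    scalRegion p Ψ 0 vQ = Set.univ := by unfold scalRegion; rw [dif_pos rfl]

/-- At a nonzero label the EMPTY monoid gives the EMPTY region — the operator is not constant. [folklore] -/
theorem scalRegion_empty {j : toyIndex.Label} (hj : j ≠ 0) (vQ : toyIndex.VQ) : scalRegion p (fun _ _ => ∅) j vQ = ∅ := by
  unfold scalRegion; rw [dif_neg hj]; ext x; simp

/-- **(hρ) EQUIVARIANCE FOR EVERY PACKET-AUTOMORPHISM FAMILY** (in particular for the whole, larger, group `⟨(Ind1) ∪ (Ind2)⟩` of the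
Joshi-style shells): every such family is a nonzero scalar on each packet line (`exists_scalar`), and `Ψ ↦ Ψ_j·𝒪` commutes with scalars;
at the zero label both sides are `univ`. [folklore] -/
theorem scalRegion_equivariant (Φ : signShells.PacketAut)
    (Ψ : ∀ v : toyIndex.V, v ∈ toyIndex.Vbad → Set (signShells.StarPacket v)) (j : toyIndex.Label) (vQ : toyIndex.VQ) :
    scalRegion p (fun v hv => signShells.starAut Φ v '' Ψ v hv) j vQ = Φ j vQ '' scalRegion p Ψ j vQ := by
  unfold scalRegion
  split_ifs with h
  · exact (Set.image_univ_of_surjective (Φ j vQ).surjective).symm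
  · obtain ⟨ε, hε0, hΦε⟩ := exists_scalar j vQ (Φ j vQ)
    have h2 : ∀ ψ : signShells.StarPacket vQ,
        line j vQ (signShells.starAut Φ vQ ψ ⟨j, h⟩) = ε * line j vQ (ψ ⟨j, h⟩) := fun ψ => hΦε _
    ext x
    constructor
    · rintro ⟨_, ⟨ψ, hψ, rfl⟩, u, hu, hx⟩
      refine ⟨(Φ j vQ).symm x, ⟨ψ, hψ, u, hu, ?_⟩, LinearEquiv.apply_symm_apply _ _⟩
      have h1 := hΦε ((Φ j vQ).symm x)
      rw [LinearEquiv.apply_symm_apply] at h1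
      rw [h2] at hx
      have h3 : ε * line j vQ ((Φ j vQ).symm x) = ε * (line j vQ (ψ ⟨j, h⟩) * line j vQ u) := by
        rw [← h1, hx, mul_assoc]
      exact mul_left_cancel₀ hε0 h3
    · rintro ⟨y, ⟨ψ, hψ, u, hu, hy⟩, rfl⟩
      refine ⟨signShells.starAut Φ vQ ψ, ⟨ψ, hψ, rfl⟩, u, hu, ?_⟩
      rw [hΦε, h2, hy, mul_assoc]

variable [hp : Fact p.Prime]

/-- The orbit of `𝒪` under a tuple set all of whose members have `j`-component `±q^e`, containing `(q^{e_j})_j` itself, is `B_e` (the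
common computation of the model of record, `PinnedWitness.orbitRegion_eq_pBall_of`, for the new operator). [folklore] -/
theorem scalRegion_eq_pBall_of {j : toyIndex.Label} (hj : j ≠ 0) (vQ : toyIndex.VQ)
    (Ψ : ∀ v : toyIndex.V, v ∈ toyIndex.Vbad → Set (signShells.StarPacket v)) (e : ℕ)
    (hΨ : ∀ ψ ∈ Ψ vQ (Set.mem_univ _),
      line j vQ (ψ ⟨j, hj⟩) = (p : ℚ) ^ e ∨ line j vQ (ψ ⟨j, hj⟩) = -(p : ℚ) ^ e)
    (ψ₀ : signShells.StarPacket vQ) (hψ₀ : ψ₀ ∈ Ψ vQ (Set.mem_univ _)) (hψ₀j : line j vQ (ψ₀ ⟨j, hj⟩) = (p : ℚ) ^ e) :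
    scalRegion p Ψ j vQ = pBall p j vQ e := by
  unfold scalRegion
  rw [dif_neg hj]
  ext x
  constructor
  · rintro ⟨ψ, hψ, u, hu, hx⟩
    show line j vQ x = 0 ∨ ((e : ℕ) : ℤ) ≤ padicValRat p (line j vQ x)
    rcases hΨ ψ hψ with h1 | h1
    · rw [hx, h1, ← one_mul ((p : ℚ) ^ e)]
      exact (mem_pBall_pow_iff p (Or.inl rfl) _ _).2 hu
    · rw [hx, h1, neg_eq_neg_one_mul]
      exact (mem_pBall_pow_iff p (Or.inr rfl) _ _).2 hu
  · intro hx
    have hx' : line j vQ x = 0 ∨ ((e : ℕ) : ℤ) ≤ padicValRat p (line j vQ x) := hx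
    refine ⟨ψ₀, hψ₀, (line j vQ).symm (line j vQ x / (p : ℚ) ^ e), ?_, ?_⟩
    · show line j vQ _ = 0 ∨ (0 : ℤ) ≤ padicValRat p (line j vQ _)
      rw [LinearEquiv.apply_symm_apply, ← mem_pBall_pow_iff p (Or.inl rfl) e, one_mul,
        mul_div_cancel₀ _ (pow_ne_zero' p _)]
      exact hx'
    · rw [LinearEquiv.apply_symm_apply, hψ₀j, mul_div_cancel₀ _ (pow_ne_zero' p _)]

/-- **The operator on the splitting monoid `Ψ_v = {(±q^{j²})_j}` gives `B_{j²}`** at `j ∈ 𝔽_l^⋆` (and the convention at `0`). [folklore] -/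
theorem scalRegion_Psi (j : toyIndex.Label) (vQ : toyIndex.VQ) :
    scalRegion p (fun v _ => Psi p v) j vQ = if j = 0 then Set.univ else pBall p j vQ (jsq j) := by
  by_cases hj : j = 0
  · subst hj; rw [if_pos rfl]; exact scalRegion_zero p _ vQ
  · rw [if_neg hj]
    exact scalRegion_eq_pBall_of p hj vQ _ ((j : ℕ) ^ 2) (fun ψ hψ => hψ ⟨j, hj⟩) (thetaValues p vQ)
      (thetaValues_mem_Psi p vQ) (LinearEquiv.apply_symm_apply _ _)

/-- **The operator on the q-pilot's Kummer datum `{(±q)_j}` gives `B_1 = q·𝒪`** at `j ∈ 𝔽_l^⋆`. [folklore] -/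
theorem scalRegion_qDatum {j : toyIndex.Label} (hj : j ≠ 0) (vQ : toyIndex.VQ) :
    scalRegion p (qDatum p) j vQ = pBall p j vQ 1 := by
  refine scalRegion_eq_pBall_of p hj vQ _ 1 (fun ψ hψ => ?_) _ (qTuple_mem_qDatum p vQ) ?_
  · have h := hψ ⟨j, hj⟩
    rw [expOf_qData] at h
    exact h
  · show line j vQ ((line j vQ).symm (p : ℚ)) = _
    rw [LinearEquiv.apply_symm_apply, pow_one]

omit hp in
/-- The column's Frobenius-like splitting monoid at every `(n, m)` IS `Ψ_v` (Thm. 3.11 (ii) (b), w5-d247's torsion-saturation). [folklore] -/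
theorem scalFull_frobΨ (n m : ℤ) : ((scalFull p).col n).frobΨ m = fun v _ => Psi p v := by
  funext v hv
  exact image_Psi_of_actsBySigns p (twist_actsBySigns m) v

/-- **(hρ) ∧ (pΘ) — the Θ-PILOT PIN HOLDS** for `scalRegion` (equivariance under the LARGER group; the `(n,m)`-Kummer image of the
Θ-pilot object IS the region of the column-`m` Kummer image of the splitting monoid). [claim: Mochizuki2012, status: disputed] -/
theorem scalSetting_thetaPinned : ThetaPinned (scalFull p).toLatticeSituation (scalSetting p) (scalRegion p) := by
  refine ⟨fun Φ _ Ψ j vQ => scalRegion_equivariant p Φ Ψ j vQ, fun m j vQ => ?_⟩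
  rw [scalFull_frobΨ, scalRegion_Psi, scalSetting_thetaRegion]

/-- **(pq′) — the q-PILOT PIN HOLDS** for the same operator and the q-pilot's own Kummer datum `qDatum`. [claim: Mochizuki2012, status: disputed] -/
theorem scalSetting_qPinned : QPinned (scalFull p).toLatticeSituation (scalSetting p) (scalRegion p) (qDatum p) := by
  intro j vQ
  by_cases hj : j = 0
  · subst hj; rw [scalSetting_qRegion, if_pos rfl, scalRegion_zero]
  · rw [scalSetting_qRegion_of_ne_zero p hj, scalRegion_qDatum p hj]

omit hp in
/-- **(pL) — the LINK PIN HOLDS**: c312-1's object-level `PilotLink` (the identity of exponents carries the Θ-pilot object, exponent `1`, to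
the q-pilot object, exponent `1`). [folklore] -/
theorem scalSetting_pilotLink : Thm311ToCor312.PilotLink (scalSetting p) :=
  ⟨Equiv.refl ℤ, by rw [scalSetting_thetaPilot]; rfl⟩

/-- **`PinnedRegions3` HOLDS** — all three pins (E-cx sign-off (iv): every pin by theorem). [claim: Mochizuki2012, status: disputed] -/
theorem scalSetting_pinnedRegions3 :
    PinnedRegions3 (scalFull p).toLatticeSituation (scalSetting p) (scalRegion p) (qDatum p) :=
  ⟨⟨scalSetting_thetaPinned p, scalSetting_qPinned p⟩, scalSetting_pilotLink p⟩

/-! ## 2. (a) S is reached through the one (Ind2)-family `untiltFamily` -/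

/-- **Y₁ ∧ Joshi's identity side HOLD for `u_j := untiltFamily`**: the untilt change is an element of `⟨(Ind1) ∪ (Ind2)⟩` (it is ONE
(Ind2)-family) and at every label the changed Θ-region IS the q-region: `untiltFamily · B_{j²} = B_1` — the conjunction X-06
(`Joshi.not_untiltChange_of_logvolInvariant`) refutes at every volume-invariant setting. [claim: Joshi2024ATS3, status: disputed] -/
theorem scalSetting_untiltChange :
    UntiltChangeIsInd (scalFull p).toLatticeSituation (fun _ => untiltFamily p) ∧
      UntiltChangeCarriesQ (scalFull p).toLatticeSituation (scalSetting p) (scalRegion p) (qDatum p) fun _ => untiltFamily p := by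
  refine ⟨fun _ => scaleFamily_mem_closure _, fun j vQ => ⟨0, ?_⟩⟩
  rw [scalFull_frobΨ, scalRegion_Psi]
  by_cases hj : j = 0
  · subst hj
    rw [scalRegion_zero, if_pos rfl]
    exact (Set.image_univ_of_surjective (untiltFamily p 0 vQ).surjective).symm
  · rw [scalRegion_qDatum p hj, if_neg hj, image_pBall_untiltFamily, add_sub_cancel]

/-- … hence the containment side `UntiltChangeCoversQ` and `IndCoversQ`. [claim: Joshi2024ATS3, status: disputed] -/
theorem scalSetting_indCoversQ : IndCoversQ (scalFull p).toLatticeSituation (scalSetting p) (scalRegion p) (qDatum p) :=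
  indCoversQ_of_pilotKummerCompatRegion (pilotKummerCompatRegion_of_untiltChange (scalSetting_untiltChange p).1
    (scalSetting_untiltChange p).2)

/-- **(a) S IS REACHED: `PilotKummerIndRelated` HOLDS at the Joshi-style instantiation** (through abc-iut-E-cx's template
`Joshi.pilotKummerIndRelated_of_untiltChange`: Y₁ + identity side + Thm. 3.11 (ii) (b) + (hρ)). [claim: Mochizuki2012, status: disputed] -/
theorem scalSetting_pilotKummerIndRelated :
    PilotKummerIndRelated (scalFull p).toLatticeSituation (scalSetting p) (scalRegion p) (qDatum p) :=
  pilotKummerIndRelated_of_untiltChange (scal_partII p (scalSetting p).n).2.1 (scalSetting_thetaPinned p).1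
    (scalSetting_untiltChange p).1 (scalSetting_untiltChange p).2

/-- `p^{1−j²}·(±q^{j²}) = ±q`: the untilt change carries the theta-value tuple set `Ψ_v` ONTO the q-datum `{(±q)_j}`. [folklore] -/
theorem starAut_untiltFamily_image_Psi (v : toyIndex.V) :
    scalShells.starAut (untiltFamily p) v '' Psi p v = qDatum p v (Set.mem_univ _) := by
  have hc : ∀ j : toyIndex.LabelStar, (p : ℚ) ^ (1 - jsq j.1) * (p : ℚ) ^ ((j.1 : ℕ) ^ 2) = (p : ℚ) ^ (1 : ℕ) := fun j => by
    rw [show ((p : ℚ) ^ ((j.1 : ℕ) ^ 2)) = (p : ℚ) ^ (jsq j.1) from (zpow_natCast _ _).symm, ← zpow_add₀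
      (Nat.cast_ne_zero.mpr hp.out.ne_zero), sub_add_cancel, zpow_one, pow_one]
  have key : ∀ f : signShells.StarPacket v, scalShells.starAut (untiltFamily p) v f ∈ qDatum p v (Set.mem_univ _) ↔ f ∈ Psi p v := by
    intro f
    refine forall_congr' fun j => ?_
    show (line j.1 _ (untiltFamily p j.1 _ (f j)) = _ ∨ line j.1 _ (untiltFamily p j.1 _ (f j)) = _) ↔ _
    rw [expOf_qData, untiltFamily, line_scaleFamily]
    show ((p : ℚ) ^ (1 - jsq j.1) * _ = _ ∨ (p : ℚ) ^ (1 - jsq j.1) * _ = _) ↔ _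
    have hne : (p : ℚ) ^ (1 - jsq j.1) ≠ 0 := ppow_ne_zero p _
    rw [← hc j, mul_right_inj' hne, ← mul_neg, mul_right_inj' hne]
  apply Set.Subset.antisymm
  · rintro _ ⟨f, hf, rfl⟩; exact (key f).2 hf
  · intro f hf
    exact ⟨(scalShells.starAut (untiltFamily p) v).symm f, (key _).1 (by rwa [LinearEquiv.apply_symm_apply]),
      LinearEquiv.apply_symm_apply _ _⟩

/-- **abc-iut-w5-d068's DATUM-LEVEL printed clause `PilotKummerCompat` (Thm. 3.11 (iii) (c), final clause, read at the pilots) HOLDS**: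
the q-pilot's Kummer datum IS the transport of the column-`0` Θ-Kummer image by the one indeterminacy `untiltFamily` — on the nose, not
only region-wise (at the model of record it FAILS: `not_pilotKummerCompat_pinnedSetting`). [claim: Mochizuki2012, status: disputed] -/
theorem scalSetting_pilotKummerCompat : PilotKummerCompat (scalFull p).toLatticeSituation (scalSetting p) (qDatum p) := by
  refine ⟨untiltFamily p, scaleFamily_mem_closure _, 0, fun v hv => ?_⟩
  rw [scalFull_frobΨ]
  exact (starAut_untiltFamily_image_Psi p v).symm

/-- **Reading R3 HOLDS**: at every label of `𝔽_l^⋆` the q-pilot image `B_1` is a possible image of the Θ-pilot object (all balls are).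
[claim: Mochizuki2012, status: disputed] -/
theorem scalSetting_reading3 (i : Fin toyIndex.lstar) (vQ : toyIndex.VQ) :
    (scalSetting p).qRegion (Setting.labelSucc i) vQ ∈ (scalSetting p).possibleImages (Setting.labelSucc i) vQ := by
  rw [scalSetting_possibleImages p (Setting.labelSucc_ne_zero i), scalSetting_qRegion_of_ne_zero p (Setting.labelSucc_ne_zero i)]
  exact ⟨1, rfl⟩

/-- **The (xi-f) `Licence` HOLDS** (R3 ⟹ Licence, abc-iut-c312-1). [claim: Mochizuki2012, status: disputed] -/
theorem scalSetting_licence : Thm311ToCor312.Licence (scalSetting p) :=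
  Thm311ToCor312.licence_of_qRegion_mem_possibleImages (scalSetting p) (scalSetting_reading3 p)

/-! ## 3. (c) The indeterminacies do NOT preserve log-volume -/

/-- **(c) `¬ LogvolInvariant`**: the (Ind2)-family `dilateFamily` carries the admissible `B_0` (log-volume `0`) onto `B_{−1}` (log-volume
`log p`) at the label `1`. (What [IUTchIV] Thm. 1.10 Step (v) uses of (Ind1), (Ind2) FAILS here; it is not a clause of the typed Thm. 3.11,
which HOLDS, `scalFull_statement`.) [folklore] -/
theorem scalSetting_not_logvolInvariant : ¬ ((scalFull p).D (scalSetting p).n).LogvolInvariant := fun h => by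
  have key : ∀ vQ : toyIndex.VQ, False := fun vQ => by
    have h0 := h (dilateFamily p) (Or.inr (scaleFamily_mem_Ind2Family _)) 1 vQ (pBall p 1 vQ 0) (Or.inr ⟨0, rfl⟩)
    rw [image_pBall_dilateFamily] at h0
    have h1 : pVol p 1 vQ (pBall p 1 vQ (0 - 1)) = pVol p 1 vQ (pBall p 1 vQ 0) := h0
    rw [pVol_pBall, pVol_pBall] at h1
    have := log_p_pos p
    push_cast at h1
    linarith
  exact key ()

/-! ## 4. (b′) The hull blow-up: the typed Statement and the bridge hypotheses FAIL -/

/-- **ESCAPE: at every `(j ∈ 𝔽_l^⋆, v_ℚ)` every hull-set `B_K` misses the possible image `B_{K−1}`** (the hypothesis of abc-iut-E-cx's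
`Joshi.not_hullDefined_of_escapes`). [folklore] -/
theorem scalSetting_escapes (i : Fin toyIndex.lstar) (vQ : toyIndex.VQ) :
    ∀ H ∈ ((scalSetting p).frame (Setting.labelSucc i) vQ).Hul,
      ∃ U ∈ (scalSetting p).possibleImages (Setting.labelSucc i) vQ, ¬ U ⊆ H := by
  intro H hH
  rw [scalSetting_frame_of_ne_zero p (Setting.labelSucc_ne_zero i)] at hH
  obtain ⟨K, rfl⟩ := hH
  refine ⟨pBall p _ vQ (K - 1), ?_, fun hsub => ?_⟩
  · rw [scalSetting_possibleImages p (Setting.labelSucc_ne_zero i)]; exact ⟨_, rfl⟩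
  · have := (pBall_subset_iff p _ vQ (K - 1) K).1 hsub; omega

/-- **`¬ HullDefined` at every packet of a label in `𝔽_l^⋆`**: the union of the possible images (the whole line) is not relatively compact.
[folklore] -/
theorem scalSetting_not_hullDefined (i : Fin toyIndex.lstar) (vQ : toyIndex.VQ) :
    ¬ (scalSetting p).HullDefined (Setting.labelSucc i) vQ :=
  not_hullDefined_of_escapes (scalSetting_escapes p i vQ)

/-- `thetaLocal = ⊤` («the holomorphic hull of U is 𝓘^ℚ((−))», Rmk. 3.9.5 (i); infinite log-volume) at every such packet. [folklore] -/
theorem scalSetting_thetaLocal_eq_top (i : Fin toyIndex.lstar) (vQ : toyIndex.VQ) :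
    (scalSetting p).thetaLocal (Setting.labelSucc i) vQ = ⊤ := by
  unfold Setting.thetaLocal; rw [if_neg (scalSetting_not_hullDefined p i vQ)]

/-- `¬ ThetaFinite`: «the quantity −|log(Θ)| is finite» FAILS as typed. [folklore] -/
theorem scalSetting_not_thetaFinite : ¬ (scalSetting p).ThetaFinite := fun h =>
  h.1 ⟨0, by decide⟩ () (scalSetting_thetaLocal_eq_top p _ ())

/-- `−|log(Θ)| = ⊤ = +∞` as typed. [folklore] -/
theorem scalSetting_negLogTheta_eq_top : (scalSetting p).negLogTheta = ⊤ := by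
  unfold Setting.negLogTheta; rw [if_neg (scalSetting_not_thetaFinite p)]

/-- **(b′) THE TYPED STATEMENT OF COR. 3.12 FAILS AND SO DO THE BRIDGE HYPOTHESES** (abc-iut-E-cx's `Joshi.not_statement_of_escapes`).
[folklore] -/
theorem scalSetting_not_statement_not_bridgeHyps : ¬ (scalSetting p).Statement ∧ ¬ BridgeHyps (scalSetting p) :=
  not_statement_of_escapes (scalSetting_escapes p ⟨0, by decide⟩ ())

/-! ## 5. `|log(q)| > 0` and the bridge-hypotheses census: only `finite` fails -/

/-- `−|log(q)| = −log p`. [folklore] -/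
theorem scalSetting_negLogQ : (scalSetting p).negLogQ = -Real.log p := by
  unfold Setting.negLogQ
  have h : (fun i : Fin toyIndex.lstar => ∑ᶠ vQ : toyIndex.VQ, (scalSetting p).qLocal (Setting.labelSucc i) vQ) =
      fun _ => -Real.log p := by
    funext i
    rw [finsum_unique]
    show pVol p _ _ ((scalSetting p).qRegion (Setting.labelSucc i) _) = _
    rw [scalSetting_qRegion_of_ne_zero p (Setting.labelSucc_ne_zero i), pVol_pBall]; push_cast; ring
  rw [h]
  exact processionNormalized_const (by decide) _

/-- **`|log(q)| > 0` HOLDS.** [folklore] -/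
theorem scalSetting_absLogQPos : (scalSetting p).AbsLogQPos := by
  show (scalSetting p).negLogQ < 0
  rw [scalSetting_negLogQ, neg_lt_zero]
  exact log_p_pos p

/-- **BRIDGE-HYPOTHESES CENSUS: every clause of `BridgeHyps` EXCEPT `finite` HOLDS** — monotone log-volume on the admissible regions of
the labels of `𝔽_l^⋆` (balls), admissible possible images (balls), finitely supported volumes, nonempty hull-sets, nonempty Θ-regions; and
`finite` (= `ThetaFinite`) FAILS. So `BridgeHyps` fails at exactly one clause. [folklore] -/
theorem scalSetting_bridge_census :
    LogvolMono (scalSetting p) ∧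
    (∀ (i : Fin toyIndex.lstar) (vQ : toyIndex.VQ), ∀ U ∈ (scalSetting p).possibleImages (Setting.labelSucc i) vQ,
      ((scalFull p).D (scalSetting p).n).Adm _ vQ U) ∧
    (∀ U : ImageChoice (scalSetting p), (Function.support fun t : Fin toyIndex.lstar × toyIndex.VQ =>
      (1 / (toyIndex.lstar : ℝ)) * ((scalFull p).D (scalSetting p).n).logvol _ t.2 (U.1 t)).Finite) ∧
    (∀ (j : toyIndex.Label) (vQ : toyIndex.VQ), ∀ H ∈ ((scalSetting p).frame j vQ).Hul, H.Nonempty) ∧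
    (∀ (i : Fin toyIndex.lstar) (vQ : toyIndex.VQ), ((scalSetting p).thetaRegion3 (Setting.labelSucc i) vQ).Nonempty) ∧
    ¬ (scalSetting p).ThetaFinite := by
  refine ⟨?_, fun i vQ U hU => ?_, fun _ => Set.toFinite _, fun j vQ H hH => ?_, fun i vQ => ?_, scalSetting_not_thetaFinite p⟩
  · rintro i vQ A B (⟨h0, -⟩ | ⟨k, rfl⟩) hB hAB
    · exact absurd h0 (Setting.labelSucc_ne_zero i)
    · rcases hB with ⟨h0, -⟩ | ⟨k', rfl⟩
      · exact absurd h0 (Setting.labelSucc_ne_zero i)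
      · exact pVol_mono p hAB
  · rw [scalSetting_possibleImages p (Setting.labelSucc_ne_zero i)] at hU
    obtain ⟨e, rfl⟩ := hU
    exact Or.inr ⟨e, rfl⟩
  · by_cases hj : j = 0
    · subst hj
      rw [scalSetting_frame_zero, mem_univFrame_hul] at hH
      rw [hH]; exact ⟨0, trivial⟩
    · rw [scalSetting_frame_of_ne_zero p hj] at hH
      obtain ⟨k, rfl⟩ := hH
      exact ⟨0, zero_mem_pBall p j vQ k⟩
  · rw [scalSetting_thetaRegion3_of_ne_zero p (Setting.labelSucc_ne_zero i)]
    exact ⟨0, zero_mem_pBall p _ vQ _⟩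

/-! ## 6. The packaged test line -/

/-- **E TEST X-07′ (Joshi-style (Ind2) at the pinned carriers), packaged.** For the instantiation `scalFull p` / `scalSetting p` with
operator `scalRegion p` and q-datum `qDatum p`: the typed [IUTchIII] Thm. 3.11 (i) ∧ (ii) ∧ (iii) HOLDS; `|log(q)| > 0`; ALL THREE PINS hold;
**S = `PilotKummerIndRelated` HOLDS** together with Y₁ ∧ the identity side (`UntiltChangeIsInd ∧ UntiltChangeCarriesQ` for
`untiltFamily`), `IndCoversQ`, the printed datum-level clause `PilotKummerCompat`, Reading R3 and the (xi-f) Licence; the indeterminacies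
do NOT preserve log-volume; and the typed Statement of Cor. 3.12 FAILS (`−|log(Θ)| = ⊤`) together with `BridgeHyps` (at the clause
`finite` only, §5). Interface level; located, not adjudicated; no side taken. [folklore] -/
theorem scal_test_X07' :
    (scalFull p).Statement ∧ (scalSetting p).AbsLogQPos ∧
    PinnedRegions3 (scalFull p).toLatticeSituation (scalSetting p) (scalRegion p) (qDatum p) ∧
    PilotKummerIndRelated (scalFull p).toLatticeSituation (scalSetting p) (scalRegion p) (qDatum p) ∧
    (UntiltChangeIsInd (scalFull p).toLatticeSituation (fun _ => untiltFamily p) ∧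
      UntiltChangeCarriesQ (scalFull p).toLatticeSituation (scalSetting p) (scalRegion p) (qDatum p) fun _ => untiltFamily p) ∧
    IndCoversQ (scalFull p).toLatticeSituation (scalSetting p) (scalRegion p) (qDatum p) ∧
    PilotKummerCompat (scalFull p).toLatticeSituation (scalSetting p) (qDatum p) ∧
    (∀ (i : Fin toyIndex.lstar) (vQ : toyIndex.VQ),
      (scalSetting p).qRegion (Setting.labelSucc i) vQ ∈ (scalSetting p).possibleImages (Setting.labelSucc i) vQ) ∧
    Thm311ToCor312.Licence (scalSetting p) ∧
    ¬ ((scalFull p).D (scalSetting p).n).LogvolInvariant ∧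
    (∀ (i : Fin toyIndex.lstar) (vQ : toyIndex.VQ), ¬ (scalSetting p).HullDefined (Setting.labelSucc i) vQ) ∧
    (scalSetting p).negLogTheta = ⊤ ∧ ¬ (scalSetting p).Statement ∧ ¬ BridgeHyps (scalSetting p) :=
  ⟨scalFull_statement p, scalSetting_absLogQPos p, scalSetting_pinnedRegions3 p, scalSetting_pilotKummerIndRelated p,
    scalSetting_untiltChange p, scalSetting_indCoversQ p, scalSetting_pilotKummerCompat p, scalSetting_reading3 p, scalSetting_licence p,
    scalSetting_not_logvolInvariant p, scalSetting_not_hullDefined p, scalSetting_negLogTheta_eq_top p,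
    (scalSetting_not_statement_not_bridgeHyps p).1, (scalSetting_not_statement_not_bridgeHyps p).2⟩

/-- **∃-form for the §M sentence**: there is an instantiation of the typed Theorem 3.11 with `|log(q)| > 0` and the three pins at which
S HOLDS while the typed Statement of Cor. 3.12 and the bridge hypotheses FAIL and the indeterminacies change log-volumes — so S does not
imply the Statement without `BridgeHyps.finite`, and `finite` is not implied by the typed Thm. 3.11 + pins + S. [folklore] -/
theorem exists_S_and_not_statement :
    ∃ (T : ThetaIndex) (F : FullSituation T) (P : Setting F.toLatticeSituation.toSituation)
      (ρ : (∀ v : T.V, v ∈ T.Vbad → Set (F.L.StarPacket v)) → ∀ (j : T.Label) (vQ : T.VQ), Set (F.L.Packet j vQ))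
      (qK : ∀ v : T.V, v ∈ T.Vbad → Set (F.L.StarPacket v)),
      F.Statement ∧ P.AbsLogQPos ∧ PinnedRegions3 F.toLatticeSituation P ρ qK ∧
      PilotKummerIndRelated F.toLatticeSituation P ρ qK ∧ PilotKummerCompat F.toLatticeSituation P qK ∧
      ¬ (F.D P.n).LogvolInvariant ∧ ¬ P.Statement ∧ ¬ BridgeHyps P := by
  haveI : Fact (Nat.Prime 2) := ⟨Nat.prime_two⟩
  exact ⟨toyIndex, scalFull 2, scalSetting 2, scalRegion 2, qDatum 2, scalFull_statement 2, scalSetting_absLogQPos 2,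
    scalSetting_pinnedRegions3 2, scalSetting_pilotKummerIndRelated 2, scalSetting_pilotKummerCompat 2,
    scalSetting_not_logvolInvariant 2, (scalSetting_not_statement_not_bridgeHyps 2).1,
    (scalSetting_not_statement_not_bridgeHyps 2).2⟩

end Summit.ABC.IUTFork.Joshi.IsmScaling

end
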